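import Summits.ABC.IUTFork.Conditional.WRowFrey31117999167337103924704Packages
import HarnessLib

/-!
# R-W «W:INH-BANDS-REFUTED-SIDE» — index shapes at the bad fibre of `2⁵·67⁸·107·22381 + 5⁴·53⁶·353⁵ = 3²²·7¹⁴·43·83` (any level `l`):
# `e(K_x/ℚ_p) = E₀(p)·l·m`, `m ≥ 1`, with the LOWER classes of `WRowFrey31117999167337103924704Packages` (part 1 of the inhabited band)

PROOF-ONLY file (D-0012; 0 definitions, 0 `Prop` facts) of the abc-iut cell — D-0079 RESCUE sub-cell R-W «WINDOW Θ-SIDE INEQUALITY», seat abc-iut-W-neg-1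
(gen 4), row «W:INH-BANDS-REFUTED-SIDE» (abc-iut-plan C-R99 (b)); pattern of abc-iut-W-num-6's `InhBand.shape_*` (`InhUniformBandShapes*`). The index at a bad
fibre point `x ∣ p` of a genuine Θ-volume datum over `(ratPoint (a/c), l)` is a positive multiple of `E₀(p)·l`, `E₀ = 30, 60, 15, 30, 5, 15, 30, 15, 3, 15` over
`3, 5, 7, 43, 53, 67, 83, 107, 353, 22381` (`WRow.bad_prime_…` / `WRow.dvd_absRamificationIdx_…` BY NAME; the TWIST class `30` at `43, 83 ∥ c`, p500830).
TAKES NO SIDE on [IUTchIII] Cor. 3.12 or on any author; typed ≠ proved; no abc claim.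
[cite: SilvermanATAEC1994, V.5 Thm. 5.3 and Cor. 5.4] [cite: Mochizuki2012, IUTchI Ex. 3.2 (iv) p. 71; IUTchIV Thm. 1.10 p. 22] [claim: Mochizuki2012, status: disputed] for every IUT quotation.
-/

noncomputable section

open Set Function Metric NumberField IsDedekindDomain

namespace Summit.ABC.IUTFork.Conditional

open Thm311 Thm311.Real Cor312 Cor312Vol Cor312Prov Literature.IUT.LogThetaLattice Literature.IUT.LogVolume
  Literature.IUT.HodgeTheaters Literature.IUT.LogVolume.Cor22
open Literature.NumberTheory.NumberFields Literature.NumberTheory.GaloisRepresentations.Ultrametric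
open Literature.NumberTheory.DiophantineGeometry Literature.NumberTheory.DiophantineGeometry.GenEll

/-- **Index shapes at the bad fibre of `2⁵·67⁸·107·22381 + 5⁴·53⁶·353⁵ = 3²²·7¹⁴·43·83`, any level `l`**: `e(K_x/ℚ_p) = E₀(p)·l·m` with `m ≥ 1`, `E₀` the LOWER class of
`WRow.dvd_absRamificationIdx_frey31117999167337103924704` (30 over 3, 60 over 5, 15 over 7, 30 over 43, 5 over 53, 15 over 67, 30 over 83, 15 over 107, 3 over 353, 15 over 22381). [cite: SilvermanATAEC1994, V.5 Thm. 5.3 and Cor. 5.4]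
[cite: Mochizuki2012, IUTchI Ex. 3.2 (iv) p. 71; IUTchIV Thm. 1.10 p. 22] [claim: Mochizuki2012, status: disputed] -/
theorem InhBand.shape_frey31117999167337103924704 {l : ℕ} (T : Cor22.ThetaVolumeDatumAt (ratPoint (((2 ^ 5 * 67 ^ 8 * 107 * 22381 : ℕ) : ℚ) / (3 ^ 22 * 7 ^ 14 * 43 * 83 : ℕ))) l) (pp : Nat.Primes) :
    letI := T.instFieldF; letI := T.instNumberFieldF; letI := T.instAlgebraF; letI := T.instFieldK
    letI := T.instNumberFieldK; letI := T.instAlgebraK; letI := T.instFieldFbar; letI := T.instAlgebraFbar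
    letI := T.instAlgebraKFbar; letI := T.instIsElliptic
    haveI : Fact (pp : ℕ).Prime := ⟨pp.2⟩
    ∀ x : (thetaIndex (pilotDataOfK T.D T.K)).Fibre (.inr pp), placeOf (pilotDataOfK T.D T.K) pp.1 x ∈ (pilotDataOfK T.D T.K).S →
      ∃ m : ℕ, 1 ≤ m ∧ absRamificationIdx (pp : ℕ) (kOf (pilotDataOfK T.D T.K) pp.1 x) = (if (pp : ℕ) = 3 then 30 else if (pp : ℕ) = 5 then 60 else if (pp : ℕ) = 7 then 15 else if (pp : ℕ) = 43 then 30 else if (pp : ℕ) = 53 then 5 else if (pp : ℕ) = 67 then 15 else if (pp : ℕ) = 83 then 30 else if (pp : ℕ) = 107 then 15 else if (pp : ℕ) = 353 then 3 else 15) * l * m := by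
  letI := T.instFieldF; letI := T.instNumberFieldF; letI := T.instAlgebraF; letI := T.instFieldK
  letI := T.instNumberFieldK; letI := T.instAlgebraK; letI := T.instFieldFbar; letI := T.instAlgebraFbar
  letI := T.instAlgebraKFbar; letI := T.instIsElliptic
  haveI : Fact (pp : ℕ).Prime := ⟨pp.2⟩
  intro x hx
  have hpos := absRamificationIdx_pos (pp : ℕ) (kOf (pilotDataOfK T.D T.K) pp.1 x)
  obtain ⟨-, hpl, -, hcases, -⟩ := WRow.bad_prime_frey31117999167337103924704 T pp x hx
  have hall := WRow.dvd_absRamificationIdx_frey31117999167337103924704 T pp hpl x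
  have hdvd : (if (pp : ℕ) = 3 then 30 else if (pp : ℕ) = 5 then 60 else if (pp : ℕ) = 7 then 15 else if (pp : ℕ) = 43 then 30 else if (pp : ℕ) = 53 then 5 else if (pp : ℕ) = 67 then 15 else if (pp : ℕ) = 83 then 30 else if (pp : ℕ) = 107 then 15 else if (pp : ℕ) = 353 then 3 else 15) * l ∣ absRamificationIdx (pp : ℕ) (kOf (pilotDataOfK T.D T.K) pp.1 x) := by
    rcases hcases with hp | hp | hp | hp | hp | hp | hp | hp | hp | hp
    · simp only [hp]; norm_num; exact hall.1 hp
    · simp only [hp]; norm_num; exact hall.2.1 hp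
    · simp only [hp]; norm_num; exact hall.2.2.1 hp
    · simp only [hp]; norm_num; exact hall.2.2.2.1 hp
    · simp only [hp]; norm_num; exact hall.2.2.2.2.1 hp
    · simp only [hp]; norm_num; exact hall.2.2.2.2.2.1 hp
    · simp only [hp]; norm_num; exact hall.2.2.2.2.2.2.1 hp
    · simp only [hp]; norm_num; exact hall.2.2.2.2.2.2.2.1 hp
    · simp only [hp]; norm_num; exact hall.2.2.2.2.2.2.2.2.1 hp
    · simp only [hp]; norm_num; exact hall.2.2.2.2.2.2.2.2.2 hp
  obtain ⟨m, hm⟩ := hdvd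
  refine ⟨m, ?_, hm⟩
  rcases Nat.eq_zero_or_pos m with h0 | h0
  · rw [h0, mul_zero] at hm; omega
  · exact h0

end Summit.ABC.IUTFork.Conditional

end
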